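import Literature.AlgebraicGeometry.Hironaka2017.S04CharAlgebra.R003PAlgebra
import Literature.AlgebraicGeometry.Resolution.HasseSchmidtDiffEqDiffOp
import Mathlib.Algebra.Polynomial.Div
import Mathlib.Algebra.CharP.Lemmas
import Mathlib.Data.Nat.Choose.Dvd
import Mathlib.RingTheory.Polynomial.Basic
import HarnessLib

/-!
# [OURS · L0 K4.6 / slot W4.6] The cusp `(yᵖ + xⁿ, p)`, I: the ARC LEMMA for the typed algebraic characteristic
# algebra `S04CharAlgebra.pAlgebraicRing` — every prime `p`, every `n > p` (cell res-hironaka, LADDER-RESOLUTION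
# rung L, D-0089; seat res-L0-k46, kill test K4.6 column (B) in kernel form; host route MarkedTransfer,
# `--supports stmt-ResolutionOfSingularities-16155`)

HONEST FRAMING. Nothing here is a statement of H. Hironaka's manuscript (2017-03-23, [Hironaka2017]) and nothing
here asserts that any statement of it holds. The objects are the tree's REAL definitions: Grothendieck's differential
operators `Resolution.diffIdeal` (EGA IV₄ 16.8) with their Hasse–Schmidt basis on `K[x,y]` (EGA IV₄ 16.11.2, tree
`hasseSchmidtDiff_eq_diffOp_of_fintype`), and the typed CANDIDATE definition of row 003,
`S04CharAlgebra.pAlgebraicRing K O J b` = «the integral closure in `Bl(Z)∗ = O[X]` of `O[⊕_{j<b} Diff^{(j)}(J) X^{b−j}]`»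
(the ALGEBRAIC definition U17_2, p.17 l.8–11, ring level) with its degree pieces `S04CharAlgebra.homogPiece`. The
theorems below are elementary commutative algebra about these definitions for ONE family of inputs (tag [folklore]);
they replace the role of the level-0 datum «the arc order of `℘(K_{p,n}, a)` is at least `a·ρ`» of the K4.6 report
(`run/shared/lean/pub/res-hironaka/L/res-L0-k46/KILL-TEST-K4.6.md` §3.2, column (B), there on paper and conditional);
NOT a statement of the manuscript. The bridge from the algebraic `℘` to the geometric one (THE carrier
`S04CharAlgebra.pAlg`, through which `Inv` of Eq. (34) is typed) is the typed candidate `U17_4` = the manuscript's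
import [23] (Hironaka 2003) and is NOT claimed here. AI review is weaker than expert review. No `sorry`; axioms standard.
Companion file (the consequences: no maximal contact, no `x̄^q` edge generator):
`Theorems/MarkedTransferCampaignW46CuspNoMaximalContact.lean`.

## What is proved (`K` any field of characteristic `p`, `p` prime, `p < n`; `O = K[x,y] = MvPolynomial (Fin 2) K`,
## `x = X 0`, `y = X 1`, `E = (J, b) = ((yᵖ + xⁿ), p)`, `℘alg = pAlgebraicRing K O J p ⊆ O[X]`; `p ∤ n` is NOT used here)

The ARC is any `K`-algebra map `φ : K[x,y] → K[τ]` with `φ x = τ^{p(p−1)}`, `φ y = −τ^{n(p−1)}` (hypotheses `hφ0`,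
`hφ1`; `MvPolynomial.aeval` of that pair is one); the «arc weight» of `x^{β₀} y^{β₁}` is `(p−1)(pβ₀ + nβ₁)`.
* `arc_cusp`: the arc kills `yᵖ + xⁿ` (`(−1)ᵖ = −1` in characteristic `p`); `arc_monomial`.
* `arc_hasseDeriv_cusp_dvd`, `diffIdeal_cusp_le` — ORDER BOUND ON THE GENERATORS: every element of
  `Diff^{≤ j}((yᵖ + xⁿ))`, `j < p`, has arc image divisible by `τ^{(p−j)·p(n−1)}`: the Hasse–Schmidt derivatives of
  order `< p` kill `yᵖ` (`C(p,k) ≡ 0 (mod p)` for `0 < k < p`) and lower `xⁿ` to `C(n,i)·x^{n−i}` (`weight_ineq`).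
* `arc_coeff_dvd_of_mem_diffSubalgebra` — the bound passes to the generated algebra `O[⊕ Diff^{(j)}(J) X^{p−j}]`
  (arc orders add): its degree-`d` coefficients have arc order `≥ d·p(n−1)`.
* `pow_dvd_of_monic_relation` — `K[τ]` is integrally closed, bare hands (`τ`-adic induction).
* `arc_dvd_of_monomial_mem` — **THE ARC LEMMA**: if `h·X^a ∈ ℘alg` then `τ^{a·p(n−1)} ∣ φ h`.
* `cusp_mem_homogPiece` (non-vacuity: `yᵖ + xⁿ ∈ ℘alg(E,p)`), `xChart_cusp` (the `x`-chart of the point blow-up sends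
  `K_{p,m+p}` to `K_{p,m}`: the cusp chain of the K4.6 table stays in the family, stage by stage).

## References

* H. Hironaka, ms. 2017-03-23, §4 p.16 l.38 – p.18 l.20 (the two definitions of `℘`, U17_1/U17_2/U17_4) — scope only,
  under adjudication, not cited as fact. [Hironaka2017]
* A. Grothendieck, J. Dieudonné, ÉGA IV₄, Publ. Math. IHÉS 32 (1967), §16.8, Thm. 16.11.2 (tree modules
  `Resolution.DifferentialOperators`, `Resolution.HasseSchmidtDiffEqDiffOp`). [EGAIV4]
* Cell res-hironaka: `L/res-L0-k46/KILL-TEST-K4.6.md` (K4.6 verdict ALIVE, kit j258573, §3.2 column (B)), typed row 003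
  `Literature/AlgebraicGeometry/Hironaka2017/S04CharAlgebra/R003PAlgebra.lean`.
-/

noncomputable section

set_option linter.dupNamespace false -- mandated namespace of this single-conjunct summit

namespace Summit.ResolutionOfSingularities.ResolutionOfSingularities.Theorems

namespace CampaignW46

namespace Cusp

open Literature.AlgebraicGeometry.Resolution
open Literature.AlgebraicGeometry.Hironaka2017.S04CharAlgebra
open MvPolynomial (X monomial)

universe u

variable {K : Type u} [Field K] {p n : ℕ}

/-! ## An exponent inequality -/

/-- The exponent inequality behind the order bound on `Diff^{(j)}(J) X^{p−j}`: for `1 ≤ i ≤ j < p ≤ n`,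
`(p−j)·p(n−1) ≤ p(p−1)(n−i)` (difference `= p·[(i−1)(n−p) + (p−1)(j−i)]`). [folklore] -/
theorem weight_ineq {p n i j : ℕ} (hi : 1 ≤ i) (hij : i ≤ j) (hjp : j < p) (hpn : p ≤ n) :
    (p - j) * (p * (n - 1)) ≤ p * (p - 1) * (n - i) := by
  obtain ⟨c, rfl⟩ := Nat.exists_eq_add_of_le hi
  obtain ⟨g, rfl⟩ := Nat.exists_eq_add_of_le hij
  obtain ⟨d, rfl⟩ := Nat.exists_eq_add_of_lt hjp
  obtain ⟨e, rfl⟩ := Nat.exists_eq_add_of_le hpn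
  have h1 : 1 + c + g + d + 1 - (1 + c + g) = d + 1 := by omega
  have h2 : 1 + c + g + d + 1 + e - 1 = c + g + d + e + 1 := by omega
  have h3 : 1 + c + g + d + 1 - 1 = c + g + d + 1 := by omega
  have h4 : 1 + c + g + d + 1 + e - (1 + c) = g + d + e + 1 := by omega
  rw [h1, h2, h3, h4]
  calc (d + 1) * ((1 + c + g + d + 1) * (c + g + d + e + 1))
      ≤ (d + 1) * ((1 + c + g + d + 1) * (c + g + d + e + 1))
          + (1 + c + g + d + 1) * (c * (g + e) + g * (g + d + e + 1)) := Nat.le_add_right _ _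
    _ = (1 + c + g + d + 1) * (c + g + d + 1) * (g + d + e + 1) := by ring

/-! ## The arc `x ↦ τ^{p(p−1)}`, `y ↦ −τ^{n(p−1)}` -/

section Arc

variable (φ : MvPolynomial (Fin 2) K →ₐ[K] Polynomial K)

/-- The arc on a monomial: `c·x^{β₀}y^{β₁} ↦ (−1)^{β₁} c · τ^{(p−1)(pβ₀ + nβ₁)}`. [folklore] -/
theorem arc_monomial (hφ0 : φ (X 0) = Polynomial.X ^ (p * (p - 1)))
    (hφ1 : φ (X 1) = -Polynomial.X ^ (n * (p - 1))) (β : Fin 2 →₀ ℕ) (c : K) :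
    φ (monomial β c) =
      Polynomial.C (c * (-1) ^ (β 1)) * Polynomial.X ^ ((p - 1) * (p * β 0 + n * β 1)) := by
  rw [MvPolynomial.monomial_eq, Finsupp.prod_fintype _ _ (fun i => pow_zero _), Fin.prod_univ_two,
    map_mul, map_mul, map_pow, map_pow, hφ0, hφ1, MvPolynomial.algHom_C, Polynomial.algebraMap_eq]
  rw [neg_pow, ← pow_mul, ← pow_mul, Polynomial.C_mul, Polynomial.C_pow, Polynomial.C_neg, Polynomial.C_1]
  ring

/-- The arc KILLS the cusp: `(−τ^{n(p−1)})ᵖ + (τ^{p(p−1)})ⁿ = 0` in characteristic `p` (`(−1)ᵖ = −1`). [folklore] -/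
theorem arc_cusp [Fact p.Prime] [CharP K p] (hφ0 : φ (X 0) = Polynomial.X ^ (p * (p - 1)))
    (hφ1 : φ (X 1) = -Polynomial.X ^ (n * (p - 1))) :
    φ (X 1 ^ p + X 0 ^ n) = 0 := by
  rw [map_add, map_pow, map_pow, hφ0, hφ1, neg_pow, ← pow_mul, ← pow_mul,
    neg_one_pow_char (Polynomial K) p]
  ring

/-! ## Hasse–Schmidt derivatives of order `< p` of the cusp, along the arc -/

/-- Lucas at the first digit: `C(p, k) = 0` in `K[x,y]` for `0 < k < p`. [folklore] -/
theorem natCast_choose_eq_zero [hp : Fact p.Prime] [CharP K p] {k : ℕ} (hk0 : k ≠ 0) (hkp : k < p) :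
    ((p.choose k : ℕ) : MvPolynomial (Fin 2) K) = 0 := by
  have h : ((p.choose k : ℕ) : K) = 0 :=
    (CharP.cast_eq_zero_iff K p _).mpr (hp.out.dvd_choose_self hk0 hkp)
  rw [← map_natCast (MvPolynomial.C : K →+* MvPolynomial (Fin 2) K), h, map_zero]

/-- ORDER BOUND ON THE GENERATORS: for `|γ| ≤ j < p` the arc image of `D^{(γ)}(yᵖ + xⁿ)` is divisible by
`τ^{(p−j)·p(n−1)}` — `D^{(γ)}` kills `yᵖ` unless `γ = 0` (then the arc kills the cusp), and lowers `xⁿ` to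
`C(n,i)·x^{n−i}` of arc order `p(p−1)(n−i) ≥ (p−j)p(n−1)` (`weight_ineq`). [folklore] -/
theorem arc_hasseDeriv_cusp_dvd [Fact p.Prime] [CharP K p] (hpn : p < n)
    (hφ0 : φ (X 0) = Polynomial.X ^ (p * (p - 1))) (hφ1 : φ (X 1) = -Polynomial.X ^ (n * (p - 1)))
    {j : ℕ} (hjp : j < p) (γ : Fin 2 →₀ ℕ) (hγ : γ.degree ≤ j) :
    Polynomial.X ^ ((p - j) * (p * (n - 1))) ∣ φ (hasseDeriv K γ (X 1 ^ p + X 0 ^ n)) := by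
  classical
  have hdeg : γ 0 + γ 1 ≤ j := by
    have h := Finsupp.degree_eq_sum γ
    rw [Fin.sum_univ_two] at h
    omega
  by_cases h0 : γ 0 = 0
  · by_cases h1 : γ 1 = 0
    · -- `γ = 0`: `D^{(0)} = id` and the arc kills the cusp
      have hγ0 : γ = 0 := by
        ext i
        fin_cases i
        · simpa using h0
        · simpa using h1
      rw [hγ0, hasseDeriv_zero_apply, arc_cusp φ hφ0 hφ1]
      exact dvd_zero _
    · -- `γ = k·e₁`, `0 < k < p`: both derivatives vanish
      have hγ1 : γ = Finsupp.single 1 (γ 1) := by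
        ext i
        fin_cases i
        · simpa using h0
        · simp
      have hA : hasseDeriv K γ ((X 1 : MvPolynomial (Fin 2) K) ^ p) = 0 := by
        conv_lhs => rw [hγ1]
        rw [hasseDeriv_X_pow, natCast_choose_eq_zero h1 (by omega), zero_mul]
      have hB : hasseDeriv K γ ((X 0 : MvPolynomial (Fin 2) K) ^ n) = 0 := by
        rw [MvPolynomial.X_pow_eq_monomial]
        refine hasseDeriv_monomial_eq_zero_of_not_le K (fun hle => h1 ?_) 1
        simpa using Finsupp.le_def.mp hle 1
      rw [map_add, hA, hB, add_zero, map_zero]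
      exact dvd_zero _
  · by_cases h1 : γ 1 = 0
    · -- `γ = i·e₀`, `1 ≤ i ≤ j`: `D^{(γ)} yᵖ = 0`, `D^{(γ)} xⁿ = C(n,i) x^{n−i}`
      have hγ0' : γ = Finsupp.single 0 (γ 0) := by
        ext i
        fin_cases i
        · simp
        · simpa using h1
      have hA : hasseDeriv K γ ((X 1 : MvPolynomial (Fin 2) K) ^ p) = 0 := by
        rw [MvPolynomial.X_pow_eq_monomial]
        refine hasseDeriv_monomial_eq_zero_of_not_le K (fun hle => h0 ?_) 1
        simpa using Finsupp.le_def.mp hle 0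
      have hB : hasseDeriv K γ ((X 0 : MvPolynomial (Fin 2) K) ^ n) =
          ((n.choose (γ 0) : ℕ) : MvPolynomial (Fin 2) K) * X 0 ^ (n - γ 0) := by
        conv_lhs => rw [hγ0']
        rw [hasseDeriv_X_pow]
      rw [map_add, hA, hB, zero_add, map_mul, map_natCast, map_pow, hφ0, ← pow_mul]
      exact Dvd.dvd.mul_left
        (pow_dvd_pow _ (weight_ineq (Nat.pos_of_ne_zero h0) (by omega) hjp hpn.le)) _
    · -- both coordinates positive: both derivatives vanish
      have hA : hasseDeriv K γ ((X 1 : MvPolynomial (Fin 2) K) ^ p) = 0 := by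
        rw [MvPolynomial.X_pow_eq_monomial]
        refine hasseDeriv_monomial_eq_zero_of_not_le K (fun hle => h0 ?_) 1
        simpa using Finsupp.le_def.mp hle 0
      have hB : hasseDeriv K γ ((X 0 : MvPolynomial (Fin 2) K) ^ n) = 0 := by
        rw [MvPolynomial.X_pow_eq_monomial]
        refine hasseDeriv_monomial_eq_zero_of_not_le K (fun hle => h1 ?_) 1
        simpa using Finsupp.le_def.mp hle 1
      rw [map_add, hA, hB, add_zero, map_zero]
      exact dvd_zero _

/-- ORDER BOUND ON `Diff^{(j)}(J)`: every element of `Diff^{≤ j}((yᵖ + xⁿ))`, `j < p`, has arc image divisible by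
`τ^{(p−j)·p(n−1)}` — differential operators of order `≤ j` on `K[x,y]` are `K[x,y]`-combinations of the `D^{(α)}`,
`|α| ≤ j` (EGA IV₄ 16.11.2, tree `hasseSchmidtDiff_eq_diffOp_of_fintype`), and Leibniz. [folklore] -/
theorem diffIdeal_cusp_le [Fact p.Prime] [CharP K p] (hpn : p < n)
    (hφ0 : φ (X 0) = Polynomial.X ^ (p * (p - 1))) (hφ1 : φ (X 1) = -Polynomial.X ^ (n * (p - 1)))
    {j : ℕ} (hjp : j < p) :
    diffIdeal K j (Ideal.span {(X 1 ^ p + X 0 ^ n : MvPolynomial (Fin 2) K)}) ≤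
      (Ideal.span {(Polynomial.X : Polynomial K) ^ ((p - j) * (p * (n - 1)))}).comap φ := by
  classical
  rw [diffIdeal_le_iff]
  intro D hD g hg
  obtain ⟨u, rfl⟩ := Ideal.mem_span_singleton'.mp hg
  have hDmem : D ∈ HasseSchmidtDiff (Fin 2) K j := by
    rw [hasseSchmidtDiff_eq_diffOp_of_fintype K j, mem_diffOp_iff]
    exact hD
  clear hD
  unfold HasseSchmidtDiff at hDmem
  induction hDmem using Submodule.span_induction with
  | mem D hD' =>
    obtain ⟨α, hα, rfl⟩ := hD'
    rw [hasseDeriv_mul]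
    refine Ideal.sum_mem _ fun q hq => Ideal.mul_mem_left _ _ ?_
    rw [Ideal.mem_comap, Ideal.mem_span_singleton]
    refine arc_hasseDeriv_cusp_dvd φ hpn hφ0 hφ1 hjp q.2 ?_
    have hq' : q.1 + q.2 = α := Finset.mem_antidiagonal.mp hq
    have hdeg : q.1.degree + q.2.degree = α.degree := by rw [← map_add, hq']
    omega
  | zero => simp only [LinearMap.zero_apply]; exact Ideal.zero_mem _
  | add D E _ _ hD hE => rw [LinearMap.add_apply]; exact Ideal.add_mem _ hD hE
  | smul a D _ hD => rw [LinearMap.smul_apply, smul_eq_mul]; exact Ideal.mul_mem_left _ _ hD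

/-! ## The order bound passes to the Diff-algebra and to its integral closure -/

/-- ORDER BOUND ON THE DIFF-ALGEBRA: for `P = Σ_d P_d X^d ∈ O[⊕_{j<p} Diff^{(j)}(J) X^{p−j}]` every coefficient
`P_d` has arc image divisible by `τ^{d·p(n−1)}` (generators: `diffIdeal_cusp_le`; closed under `+`, `·` and
`O`-scalars since arc orders add). [folklore] -/
theorem arc_coeff_dvd_of_mem_diffSubalgebra [Fact p.Prime] [CharP K p] (hpn : p < n)
    (hφ0 : φ (X 0) = Polynomial.X ^ (p * (p - 1))) (hφ1 : φ (X 1) = -Polynomial.X ^ (n * (p - 1)))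
    {P : Polynomial (MvPolynomial (Fin 2) K)}
    (hP : P ∈ diffSubalgebra K (MvPolynomial (Fin 2) K) (Ideal.span {(X 1 ^ p + X 0 ^ n)}) p) (d : ℕ) :
    Polynomial.X ^ (d * (p * (n - 1))) ∣ φ (P.coeff d) := by
  classical
  unfold diffSubalgebra at hP
  induction hP using Algebra.adjoin_induction generalizing d with
  | mem P hP =>
    obtain ⟨j, hj, c, hc, rfl⟩ := hP
    rw [Polynomial.coeff_monomial]
    split_ifs with hd
    · subst hd
      have h := diffIdeal_cusp_le φ hpn hφ0 hφ1 hj hc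
      rw [Ideal.mem_comap, Ideal.mem_span_singleton] at h
      exact h
    · rw [map_zero]
      exact dvd_zero _
  | algebraMap r =>
    rw [← Polynomial.C_eq_algebraMap, Polynomial.coeff_C]
    split_ifs with hd
    · subst hd
      rw [zero_mul, pow_zero]
      exact one_dvd _
    · rw [map_zero]
      exact dvd_zero _
  | add P Q _ _ hP hQ =>
    rw [Polynomial.coeff_add, map_add]
    exact dvd_add (hP d) (hQ d)
  | mul P Q _ _ hP hQ =>
    rw [Polynomial.coeff_mul, map_sum]
    refine Finset.dvd_sum fun x hx => ?_
    rw [map_mul, ← Finset.mem_antidiagonal.mp hx, add_mul, pow_add]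
    exact mul_dvd_mul (hP x.1) (hQ x.2)

end Arc

/-- `K[τ]` is integrally closed, bare hands: if `w^N + Σ_{i<N} c_i w^i = 0` with `τ^{(N−i)M} ∣ c_i` then `τ^M ∣ w`
(induction on `k ≤ M`: `τ^k ∣ w` and `k < M` give `τ^{Nk+1} ∣ w^N`, hence `τ ∣ (w/τ^k)^N`, hence `τ^{k+1} ∣ w`
since `τ` is prime). [folklore] -/
theorem pow_dvd_of_monic_relation {N M : ℕ} {w : Polynomial K} (c : ℕ → Polynomial K)
    (hcN : c N = 1) (hc : ∀ i < N, Polynomial.X ^ ((N - i) * M) ∣ c i)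
    (hsum : ∑ i ∈ Finset.range (N + 1), c i * w ^ i = 0) : Polynomial.X ^ M ∣ w := by
  have hrel : w ^ N = -∑ i ∈ Finset.range N, c i * w ^ i := by
    rw [Finset.sum_range_succ, hcN, one_mul] at hsum
    linear_combination hsum
  suffices key : ∀ k, k ≤ M → Polynomial.X ^ k ∣ w from key M le_rfl
  intro k
  induction k with
  | zero =>
    intro _
    exact ⟨w, by rw [pow_zero, one_mul]⟩
  | succ k ih =>
    intro hk
    obtain ⟨w', hw'⟩ := ih (Nat.le_of_succ_le hk)
    have hdiv : (Polynomial.X : Polynomial K) ^ (N * k + 1) ∣ (Polynomial.X ^ k) ^ N * w' ^ N := by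
      rw [← mul_pow, ← hw', hrel, dvd_neg]
      refine Finset.dvd_sum fun i hi => ?_
      have hi' : i < N := Finset.mem_range.mp hi
      obtain ⟨e, he⟩ := hc i hi'
      rw [he, hw', mul_pow, ← pow_mul]
      have hexp : N * k + 1 ≤ (N - i) * M + k * i := by
        obtain ⟨t, ht⟩ := Nat.exists_eq_add_of_lt hi'
        obtain ⟨s, hs⟩ := Nat.exists_eq_add_of_le hk
        have hNi : N - i = t + 1 := by omega
        rw [hNi, hs, ht]
        nlinarith [Nat.zero_le (t * s), Nat.zero_le t, Nat.zero_le s, Nat.zero_le (k * i)]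
      calc (Polynomial.X : Polynomial K) ^ (N * k + 1)
          ∣ Polynomial.X ^ ((N - i) * M + k * i) := pow_dvd_pow _ hexp
        _ ∣ Polynomial.X ^ ((N - i) * M) * e * (Polynomial.X ^ (k * i) * w' ^ i) :=
            ⟨e * w' ^ i, by rw [pow_add]; ring⟩
    rw [← pow_mul, mul_comm k N, pow_succ] at hdiv
    have hX : Polynomial.X ∣ w' ^ N :=
      (mul_dvd_mul_iff_left (pow_ne_zero _ Polynomial.X_ne_zero)).mp hdiv
    obtain ⟨w'', hw''⟩ := Polynomial.prime_X.dvd_of_dvd_pow hX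
    exact ⟨w'', by rw [hw', hw'', pow_succ, mul_assoc]⟩

/-- [OURS · L0 K4.6; NOT a statement of the manuscript] **THE ARC LEMMA.** If `h·X^a` lies in the typed algebraic
characteristic algebra `℘alg = pAlgebraicRing K K[x,y] (yᵖ + xⁿ) p` (integral closure of the Diff-algebra in
`K[x,y][X]`), then `τ^{a·p(n−1)}` divides the arc image `φ h = h(τ^{p(p−1)}, −τ^{n(p−1)})`: the degree-`aN`
coefficient of an integral dependence relation of `h X^a` over the Diff-algebra is a monic relation for `h` whose
`i`-th coefficient is a degree-`a(N−i)` coefficient of the algebra (`arc_coeff_dvd_of_mem_diffSubalgebra`), and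
`pow_dvd_of_monic_relation` concludes. Uses only `p` prime, `char K = p`, `p < n`. [folklore] -/
theorem arc_dvd_of_monomial_mem [Fact p.Prime] [CharP K p] (hpn : p < n)
    (φ : MvPolynomial (Fin 2) K →ₐ[K] Polynomial K)
    (hφ0 : φ (X 0) = Polynomial.X ^ (p * (p - 1))) (hφ1 : φ (X 1) = -Polynomial.X ^ (n * (p - 1)))
    {a : ℕ} {h : MvPolynomial (Fin 2) K}
    (hh : Polynomial.monomial a h ∈
      pAlgebraicRing K (MvPolynomial (Fin 2) K) (Ideal.span {(X 1 ^ p + X 0 ^ n)}) p) :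
    Polynomial.X ^ (a * (p * (n - 1))) ∣ φ h := by
  classical
  -- the Diff-algebra `A = O[⊕_{j<p} Diff^{(j)}(J) X^{p−j}]`
  have hint : IsIntegral (diffSubalgebra K (MvPolynomial (Fin 2) K) (Ideal.span {(X 1 ^ p + X 0 ^ n)}) p)
      (Polynomial.monomial a h) := by
    have h' := hh
    rw [pAlgebraicRing, Subalgebra.mem_restrictScalars, mem_integralClosure_iff] at h'
    exact h'
  obtain ⟨P, hmonic, heval⟩ := hint
  obtain ⟨N, hN⟩ : ∃ N, P.natDegree = N := ⟨_, rfl⟩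
  have hcN : P.coeff N = 1 := hN ▸ hmonic.coeff_natDegree
  rw [Polynomial.eval₂_eq_sum_range, hN] at heval
  -- `c i ∈ O`: the degree-`a(N−i)` coefficient of the `i`-th coefficient of the monic relation
  set c : ℕ → MvPolynomial (Fin 2) K := fun i =>
    ((P.coeff i : diffSubalgebra K (MvPolynomial (Fin 2) K) (Ideal.span {(X 1 ^ p + X 0 ^ n)}) p) :
      Polynomial (MvPolynomial (Fin 2) K)).coeff (a * (N - i)) with hc
  have hterm : ∀ i ∈ Finset.range (N + 1),
      ((algebraMap (diffSubalgebra K (MvPolynomial (Fin 2) K) (Ideal.span {(X 1 ^ p + X 0 ^ n)}) p)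
          (Polynomial (MvPolynomial (Fin 2) K)) (P.coeff i)) * (Polynomial.monomial a h) ^ i).coeff (a * N)
        = c i * h ^ i := by
    intro i hi
    have hi' : i ≤ N := Nat.lt_succ_iff.mp (Finset.mem_range.mp hi)
    have hsplit : a * N = a * (N - i) + a * i := by rw [← mul_add, Nat.sub_add_cancel hi']
    rw [Polynomial.monomial_pow, Subalgebra.algebraMap_apply, hsplit, Polynomial.coeff_mul_monomial]
  have hcoef : ∑ i ∈ Finset.range (N + 1), c i * h ^ i = 0 := by
    have h0 := congrArg (fun Q : Polynomial (MvPolynomial (Fin 2) K) => Q.coeff (a * N)) heval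
    simp only [Polynomial.finsetSum_coeff, Polynomial.coeff_zero] at h0
    rw [Finset.sum_congr rfl hterm] at h0
    exact h0
  have hsum : ∑ i ∈ Finset.range (N + 1), φ (c i) * (φ h) ^ i = 0 := by
    have h0 := congrArg φ hcoef
    rw [map_sum, map_zero] at h0
    simpa only [map_mul, map_pow] using h0
  refine pow_dvd_of_monic_relation (fun i => φ (c i)) ?_ ?_ hsum
  · simp only [hc, hcN, OneMemClass.coe_one, Nat.sub_self, mul_zero, Polynomial.coeff_one_zero, map_one]
  · intro i _
    have h0 := arc_coeff_dvd_of_mem_diffSubalgebra φ hpn hφ0 hφ1 (P.coeff i).2 (a * (N - i))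
    rwa [show (N - i) * (a * (p * (n - 1))) = a * (N - i) * (p * (n - 1)) by ring]

/-! ## Non-vacuity and the cusp chain -/

/-- [OURS · L0 K4.6; NOT a statement of the manuscript] Non-vacuity: the cusp itself lies in the degree-`p` piece,
`(yᵖ + xⁿ)·Xᵖ ∈ ℘alg` (a generator with `j = 0`), with initial form `ȳᵖ` for `p < n` — so the degree-`p` piece is
NOT inside `(x,y)^{p+1}`, while (companion file) nothing of order one and no `x̄^q` ever appears. [folklore] -/
theorem cusp_mem_homogPiece [hp : Fact p.Prime] :
    (X 1 ^ p + X 0 ^ n : MvPolynomial (Fin 2) K) ∈ homogPiece (MvPolynomial (Fin 2) K)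
      (pAlgebraicRing K (MvPolynomial (Fin 2) K) (Ideal.span {(X 1 ^ p + X 0 ^ n)}) p) p := by
  rw [homogPiece, Submodule.mem_comap, Subalgebra.mem_toSubmodule, pAlgebraicRing,
    Subalgebra.mem_restrictScalars, mem_integralClosure_iff]
  have hmem : Polynomial.monomial p (X 1 ^ p + X 0 ^ n : MvPolynomial (Fin 2) K) ∈
      diffSubalgebra K (MvPolynomial (Fin 2) K) (Ideal.span {(X 1 ^ p + X 0 ^ n)}) p := by
    refine Algebra.subset_adjoin ⟨0, hp.out.pos, X 1 ^ p + X 0 ^ n, ?_, rfl⟩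
    exact le_diffIdeal K 0 _ (Ideal.subset_span rfl)
  exact isIntegral_algebraMap
    (x := (⟨_, hmem⟩ : diffSubalgebra K (MvPolynomial (Fin 2) K) (Ideal.span {(X 1 ^ p + X 0 ^ n)}) p))

/-- [OURS · L0 K4.6; NOT a statement of the manuscript] The cusp chain stays in the family: in the `x`-chart of the
blow-up of the origin (`x ↦ x`, `y ↦ x·y`) the total transform of `yᵖ + x^{m+p}` is `xᵖ·(yᵖ + x^m)`, i.e. the
controlled transform of `K_{p,m+p} = (yᵖ + x^{m+p}, p)` at the `x`-chart origin is `K_{p,m}` — the step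
`n ↦ n − p` of the K4.6 table; every singular stage of the chain is again a cusp of the family, to which the arc
lemma and the companion file's theorems apply verbatim as long as `m > p`. [folklore] -/
theorem xChart_cusp (m : ℕ) :
    MvPolynomial.aeval ![(X 0 : MvPolynomial (Fin 2) K), X 0 * X 1]
        (X 1 ^ p + X 0 ^ (m + p) : MvPolynomial (Fin 2) K) =
      (X 0 : MvPolynomial (Fin 2) K) ^ p * (X 1 ^ p + X 0 ^ m) := by
  rw [map_add, map_pow, map_pow, MvPolynomial.aeval_X, MvPolynomial.aeval_X]
  show ((X 0 : MvPolynomial (Fin 2) K) * X 1) ^ p + (X 0 : MvPolynomial (Fin 2) K) ^ (m + p) = _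
  ring

end Cusp

end CampaignW46

end Summit.ResolutionOfSingularities.ResolutionOfSingularities.Theorems

end
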